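import Summits.BirchSwinnertonDyer.BirchSwinnertonDyer.Theorems.SignedLowerHalvesSmallImageLowerHalfBothSignsRttCharRoadE2JunctionShaSocket
import HarnessLib

/-!
# Route `SignedLowerHalves`, crux L `SmallImageLowerHalfBothSigns` (stmt-BirchSwinnertonDyer-23599), line `rtt_w3` v14 → v15 — E2, DEPLETED junction (RULING (F1)):
# THE FOUR-TERM SOCKET for the new J4 target `hY'` and the SOCKET for the depleted specialisation `s'` (row J2⁺)

WHY (LEAD `cruxlead-stmt-BirchSwinnertonDyer-23599` g11, sequel of `…RttCharRoadE2JunctionDepleted` p783844 / `…OfDepletedJunction` p784031). The depleted consumers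
take `hY' : λ(H2/f) + λ(Λ_𝒪 ⧸ (E)) ≤ λ(coker gX) + λ(B ⧸ range ιB)` (`ιB : B' ↪ B` the S₀K-strict sub-carrier, `E` the depletion). This file shows that
`hY'` is the PRIMITIVE Ш-inequality in disguise. §1 ★★ `lambdaInvariant_fourTerm_eq`: for `Λ`-linear `ιB : B' → B`, `loc : B → Hloc`, `δ : Hloc → Y`,
`π : Y ↠ Y'` with `Exact ιB loc`, `Exact loc δ`, `Exact δ π` (in E2: `Hloc = ⊕_{w ∈ S₀K} 𝐇¹(K_{∞,w}, T*)`, `Y = coker gX = X₀^{rel}` the `v`-strict,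
S₀K-relaxed dual Selmer, `Y' = X₀^{str}` its S₀K-strict quotient — the compact Poitou–Tate sequence at S₀K), `Hloc` and `Y` f.g. torsion:
`λ(Y) + λ(B ⧸ range ιB) = λ(Y') + λ(Hloc)`. ★★ `lambdaInvariant_add_le_of_fourTerm`: hence `hY'` from `hSha : λ(Y2) ≤ λ(Y')` (the Ш-socket of
`…JunctionShaSocket`, now into the STRICT object) and `hE : λ(ΛE) ≤ λ(Hloc)` (in E2: `E = ∏_{w∈S₀K} E_w` with `𝐇¹(K_{∞,w}, T*) ≅ Λ_𝒪/(E_w)` cyclic for the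
rank-one `T* = 𝒪(θ*)`, `p ≥ 5`); `_restrictScalars` variants for `Λ_𝒪`-linear maps (the consumers' shape, `B ⧸ LinearMap.range ιB` literal).
§2 ★ `exists_linearMap_comp_eq_smul`: the depleted specialisation `s' : M →ₗ B'` with `ιB ∘ s' = E • s` exists as soon as `ιB` is injective and
`E • b ∈ range ιB` for all `b` (in E2: `E` annihilates `Hloc`, i.e. `loc (E • b) = 0`) — `exists_linearMap_comp_eq_smul_of_exact` says it with `loc`.

THEOREMS ONLY (`--supports stmt-BirchSwinnertonDyer-23599` helper); closes nothing; crux L, crux M, E2 and BSD remain OPEN and are proved for NO curve by any of this.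
[cite: Washington1997, §13.2] [cite: NeukirchSchmidtWingberg2008, Ch. VIII §6 (8.6.10)] [cite: GreenbergVatsal2000, §2 Prop. (2.1), Cor. (2.3), Prop. (2.4)]
-/

set_option autoImplicit false
-- the Theorems namespace of this sub repeats the summit name by design (D-0017 nested layout)
set_option linter.dupNamespace false

noncomputable section

open Literature.NumberTheory.EllipticCurves Literature.NumberTheory.EllipticCurves.IwasawaDual
open Summit.BirchSwinnertonDyer.Rank1Residual.X2.DualRestrictionInvariants (lambdaInvariant_eq_add_of_surjective)

namespace Summit.BirchSwinnertonDyer.BirchSwinnertonDyer.Theorems.SmallImageRttCharRoad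

universe u₁ u₂ u₃ u₄ u₅ u₆ u₇

variable {p : ℕ} [Fact p.Prime]

/-! ## §1 The four-term identity and `hY'` -/

section Lambda

variable {B' : Type u₁} {B : Type u₂} {Hloc : Type u₃} {Y : Type u₄} {Y' : Type u₅} {Y2 : Type u₆} {ΛE : Type u₇}
  [AddCommGroup B'] [Module (IwasawaAlgebra p) B'] [AddCommGroup B] [Module (IwasawaAlgebra p) B]
  [AddCommGroup Hloc] [Module (IwasawaAlgebra p) Hloc] [AddCommGroup Y] [Module (IwasawaAlgebra p) Y]
  [AddCommGroup Y'] [Module (IwasawaAlgebra p) Y'] [AddCommGroup Y2] [Module (IwasawaAlgebra p) Y2] [AddCommGroup ΛE] [Module (IwasawaAlgebra p) ΛE]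

/-- ★★ **The four-term identity.** `B' → B → Hloc → Y ↠ Y'` exact at `B`, `Hloc`, `Y`, with `Hloc`, `Y` finitely generated torsion:
`λ(Y) + λ(B ⧸ range ιB) = λ(Y') + λ(Hloc)` (`B ⧸ range ιB ≅ range loc = ker δ`, `range δ = ker π`, additivity of `λ`).
[cite: Washington1997, §13.2] [cite: NeukirchSchmidtWingberg2008, Ch. VIII §6 (8.6.10)] -/
theorem lambdaInvariant_fourTerm_eq (ιB : B' →ₗ[IwasawaAlgebra p] B) (loc : B →ₗ[IwasawaAlgebra p] Hloc) (δ : Hloc →ₗ[IwasawaAlgebra p] Y)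
    (π : Y →ₗ[IwasawaAlgebra p] Y') (h₁ : Function.Exact ιB loc) (h₂ : Function.Exact loc δ) (h₃ : Function.Exact δ π)
    (hπ : Function.Surjective π) [Module.Finite (IwasawaAlgebra p) Hloc] (hH : Module.IsTorsion (IwasawaAlgebra p) Hloc)
    [Module.Finite (IwasawaAlgebra p) Y] (hY : Module.IsTorsion (IwasawaAlgebra p) Y) :
    lambdaInvariant p Y + lambdaInvariant p (B ⧸ LinearMap.range ιB) = lambdaInvariant p Y' + lambdaInvariant p Hloc := by
  have hA := lambdaInvariant_eq_add_of_surjective p π hY hπ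
  have hB := lambdaInvariant_eq_add_of_surjective p δ.rangeRestrict hH (LinearMap.surjective_rangeRestrict δ)
  have hkπ : LinearMap.ker π = LinearMap.range δ := LinearMap.exact_iff.mp h₃
  have hkδ : LinearMap.ker δ.rangeRestrict = LinearMap.range loc := (LinearMap.ker_rangeRestrict δ).trans (LinearMap.exact_iff.mp h₂)
  have hkl : LinearMap.ker loc = LinearMap.range ιB := LinearMap.exact_iff.mp h₁
  have e : (B ⧸ LinearMap.range ιB) ≃ₗ[IwasawaAlgebra p] LinearMap.range loc :=
    (Submodule.quotEquivOfEq _ _ hkl.symm).trans loc.quotKerEquivRange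
  rw [lambdaInvariant_eq_of_linearEquiv e, hA, lambdaInvariant_eq_of_linearEquiv (LinearEquiv.ofEq _ _ hkπ), hB,
    lambdaInvariant_eq_of_linearEquiv (LinearEquiv.ofEq _ _ hkδ)]
  omega

/-- ★★ **`hY'` from the four-term sequence**, the Ш-inequality into the STRICT object `hSha : λ(Y2) ≤ λ(Y')` and the local count `hE : λ(ΛE) ≤ λ(Hloc)`:
`λ(Y2) + λ(ΛE) ≤ λ(Y) + λ(B ⧸ range ιB)`. [cite: Washington1997, §13.2] [cite: GreenbergVatsal2000, §2 Cor. (2.3), Prop. (2.4)] -/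
theorem lambdaInvariant_add_le_of_fourTerm (ιB : B' →ₗ[IwasawaAlgebra p] B) (loc : B →ₗ[IwasawaAlgebra p] Hloc) (δ : Hloc →ₗ[IwasawaAlgebra p] Y)
    (π : Y →ₗ[IwasawaAlgebra p] Y') (h₁ : Function.Exact ιB loc) (h₂ : Function.Exact loc δ) (h₃ : Function.Exact δ π)
    (hπ : Function.Surjective π) [Module.Finite (IwasawaAlgebra p) Hloc] (hH : Module.IsTorsion (IwasawaAlgebra p) Hloc)
    [Module.Finite (IwasawaAlgebra p) Y] (hY : Module.IsTorsion (IwasawaAlgebra p) Y)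
    (hSha : lambdaInvariant p Y2 ≤ lambdaInvariant p Y') (hE : lambdaInvariant p ΛE ≤ lambdaInvariant p Hloc) :
    lambdaInvariant p Y2 + lambdaInvariant p ΛE ≤ lambdaInvariant p Y + lambdaInvariant p (B ⧸ LinearMap.range ιB) := by
  have h := lambdaInvariant_fourTerm_eq ιB loc δ π h₁ h₂ h₃ hπ hH hY
  omega

end Lambda

section LambdaO

variable {S : Set (PadicAlgCl p)} [Algebra (IwasawaAlgebra p) (IwasawaAlgebraO S)]
  {B' : Type u₁} {B : Type u₂} {Hloc : Type u₃} {Y : Type u₄} {Y' : Type u₅} {Y2 : Type u₆} {ΛE : Type u₇}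
  [AddCommGroup B'] [Module (IwasawaAlgebraO S) B'] [Module (IwasawaAlgebra p) B'] [IsScalarTower (IwasawaAlgebra p) (IwasawaAlgebraO S) B']
  [AddCommGroup B] [Module (IwasawaAlgebraO S) B] [Module (IwasawaAlgebra p) B] [IsScalarTower (IwasawaAlgebra p) (IwasawaAlgebraO S) B]
  [AddCommGroup Hloc] [Module (IwasawaAlgebraO S) Hloc] [Module (IwasawaAlgebra p) Hloc] [IsScalarTower (IwasawaAlgebra p) (IwasawaAlgebraO S) Hloc]
  [AddCommGroup Y] [Module (IwasawaAlgebraO S) Y] [Module (IwasawaAlgebra p) Y] [IsScalarTower (IwasawaAlgebra p) (IwasawaAlgebraO S) Y]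
  [AddCommGroup Y'] [Module (IwasawaAlgebraO S) Y'] [Module (IwasawaAlgebra p) Y'] [IsScalarTower (IwasawaAlgebra p) (IwasawaAlgebraO S) Y']
  [AddCommGroup Y2] [Module (IwasawaAlgebra p) Y2] [AddCommGroup ΛE] [Module (IwasawaAlgebra p) ΛE]

/-- `λ(B ⧸ range (ιB.restrictScalars Λ)) = λ(B ⧸ range ιB)` (the same quotient). [folklore] -/
theorem lambdaInvariant_quotient_range_restrictScalars (ιB : B' →ₗ[IwasawaAlgebraO S] B) :
    lambdaInvariant p (B ⧸ LinearMap.range (ιB.restrictScalars (IwasawaAlgebra p))) = lambdaInvariant p (B ⧸ LinearMap.range ιB) := by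
  have h : LinearMap.range (ιB.restrictScalars (IwasawaAlgebra p)) = (LinearMap.range ιB).restrictScalars (IwasawaAlgebra p) :=
    LinearMap.range_restrictScalars ιB
  exact lambdaInvariant_eq_of_linearEquiv
    ((Submodule.quotEquivOfEq _ _ h).trans (Submodule.Quotient.restrictScalarsEquiv (IwasawaAlgebra p) (LinearMap.range ιB)))

/-- ★★ **The four-term identity for `Λ_𝒪`-linear maps** (the consumers' literal `B ⧸ LinearMap.range ιB`). [cite: Washington1997, §13.2]
[cite: NeukirchSchmidtWingberg2008, Ch. VIII §6 (8.6.10)] -/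
theorem lambdaInvariant_fourTerm_eq_restrictScalars (ιB : B' →ₗ[IwasawaAlgebraO S] B) (loc : B →ₗ[IwasawaAlgebraO S] Hloc)
    (δ : Hloc →ₗ[IwasawaAlgebraO S] Y) (π : Y →ₗ[IwasawaAlgebraO S] Y') (h₁ : Function.Exact ιB loc) (h₂ : Function.Exact loc δ)
    (h₃ : Function.Exact δ π) (hπ : Function.Surjective π) [Module.Finite (IwasawaAlgebra p) Hloc] (hH : Module.IsTorsion (IwasawaAlgebra p) Hloc)
    [Module.Finite (IwasawaAlgebra p) Y] (hY : Module.IsTorsion (IwasawaAlgebra p) Y) :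
    lambdaInvariant p Y + lambdaInvariant p (B ⧸ LinearMap.range ιB) = lambdaInvariant p Y' + lambdaInvariant p Hloc := by
  rw [← lambdaInvariant_quotient_range_restrictScalars ιB]
  exact lambdaInvariant_fourTerm_eq (ιB.restrictScalars (IwasawaAlgebra p)) (loc.restrictScalars (IwasawaAlgebra p))
    (δ.restrictScalars (IwasawaAlgebra p)) (π.restrictScalars (IwasawaAlgebra p)) h₁ h₂ h₃ hπ hH hY

/-- ★★ **`hY'` for `Λ_𝒪`-linear maps**: the binder `hY` of `charRoad_E2_of_roadD_junction_depleted` (p784031) with `Y2 := H2/f`, `ΛE := Λ_𝒪 ⧸ (E)`,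
`Y := coker gX`, from the four-term sequence + `hSha` + `hE`. [cite: Washington1997, §13.2] [cite: GreenbergVatsal2000, §2 Cor. (2.3), Prop. (2.4)] -/
theorem lambdaInvariant_add_le_of_fourTerm_restrictScalars (ιB : B' →ₗ[IwasawaAlgebraO S] B) (loc : B →ₗ[IwasawaAlgebraO S] Hloc)
    (δ : Hloc →ₗ[IwasawaAlgebraO S] Y) (π : Y →ₗ[IwasawaAlgebraO S] Y') (h₁ : Function.Exact ιB loc) (h₂ : Function.Exact loc δ)
    (h₃ : Function.Exact δ π) (hπ : Function.Surjective π) [Module.Finite (IwasawaAlgebra p) Hloc] (hH : Module.IsTorsion (IwasawaAlgebra p) Hloc)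
    [Module.Finite (IwasawaAlgebra p) Y] (hY : Module.IsTorsion (IwasawaAlgebra p) Y)
    (hSha : lambdaInvariant p Y2 ≤ lambdaInvariant p Y') (hE : lambdaInvariant p ΛE ≤ lambdaInvariant p Hloc) :
    lambdaInvariant p Y2 + lambdaInvariant p ΛE ≤ lambdaInvariant p Y + lambdaInvariant p (B ⧸ LinearMap.range ιB) := by
  have h := lambdaInvariant_fourTerm_eq_restrictScalars ιB loc δ π h₁ h₂ h₃ hπ hH hY
  omega

end LambdaO

/-! ## §2 Row J2⁺: the depleted specialisation `s'` -/

section Deplete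

variable {R : Type u₁} [CommRing R] {M : Type u₂} {B' : Type u₃} {B : Type u₄} {Hloc : Type u₅}
  [AddCommGroup M] [Module R M] [AddCommGroup B'] [Module R B'] [AddCommGroup B] [Module R B] [AddCommGroup Hloc] [Module R Hloc]

/-- ★ **The depleted specialisation.** If `ιB : B' → B` is injective and `E • b ∈ range ιB` for every `b`, then for every `s : M → B` there is
`s' : M → B'` linear with `ιB (s' x) = E • s x` — the binders `s'`, `hs'` of `charRoad_E2_of_roadD_junction_depleted` (p784031). [folklore] -/
theorem exists_linearMap_comp_eq_smul (ιB : B' →ₗ[R] B) (hιB : Function.Injective ιB) (E : R) (hEB : ∀ b : B, E • b ∈ LinearMap.range ιB)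
    (s : M →ₗ[R] B) : ∃ s' : M →ₗ[R] B', ∀ x, ιB (s' x) = E • s x := by
  -- `E • _ : B → B` lands in `range ιB`; pull back along `B' ≃ range ιB`
  let mE : B →ₗ[R] LinearMap.range ιB := LinearMap.codRestrict (LinearMap.range ιB) (E • LinearMap.id) fun b ↦ hEB b
  let e : B' ≃ₗ[R] LinearMap.range ιB := LinearEquiv.ofInjective ιB hιB
  refine ⟨e.symm.toLinearMap ∘ₗ mE ∘ₗ s, fun x ↦ ?_⟩
  have h1 : (e (e.symm (mE (s x))) : B) = mE (s x) := by rw [LinearEquiv.apply_symm_apply]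
  rw [LinearEquiv.ofInjective_apply] at h1
  have h2 : ((mE (s x) : LinearMap.range ιB) : B) = E • s x := rfl
  rw [LinearMap.comp_apply, LinearMap.comp_apply, LinearEquiv.coe_toLinearMap, h1, h2]

/-- ★ **The depleted specialisation from a localisation map**: if `B' → B → Hloc` is exact at `B`, `ιB` injective and `E` annihilates `Hloc`
(in E2: `E = ∏_{w∈S₀K} E_w` kills `⊕_w 𝐇¹(K_{∞,w}, T*)`), then `s'` with `ιB ∘ s' = E • s` exists. [folklore] -/
theorem exists_linearMap_comp_eq_smul_of_exact (ιB : B' →ₗ[R] B) (hιB : Function.Injective ιB) (loc : B →ₗ[R] Hloc)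
    (hex : Function.Exact ιB loc) (E : R) (hE : ∀ y : Hloc, E • y = 0) (s : M →ₗ[R] B) :
    ∃ s' : M →ₗ[R] B', ∀ x, ιB (s' x) = E • s x := by
  refine exists_linearMap_comp_eq_smul ιB hιB E (fun b ↦ ?_) s
  exact (hex (E • b)).mp (by rw [map_smul, hE])

end Deplete

end Summit.BirchSwinnertonDyer.BirchSwinnertonDyer.Theorems.SmallImageRttCharRoad

end
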